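import Summits.NavierStokesRegularity.NavierStokesRegularity.Theorems.SoloRefuteSvancara2025
import HarnessLib

/-!
# C96 `Svancara2025` — file 2 (records-grade): the REF's charitable re-typing of Step 3, with the
# print's own blow-up profile (bounded per time, lim sup at `t*⁻`), is false for every `κ ≠ 0`

D-0090 NS-CLAIMS SWEEP, ns-claims-refuter-2 (g6), refuter of record; companion to
`Summits.NavierStokesRegularity.NavierStokesRegularity.Theorems.SoloRefuteSvancara2025` (kit 1); skeleton
`Literature.Claims.NS.Svancara2025` (ns-claims-typist-6 g5); text of record OSF egxnq (2025-12-09), PDF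
sha16 b764580eab7e30d2, 4 pp.

The REF (ns-claims-ref-4 g5, `claims/Svancara2025/RETYPE.md` v1b) handed back ONE maximally charitable
functions-grain re-typing of §2 Proof p.4 l.13–16: `Step3_CorrespondenceCharitable` — the typed Step 3 with
its blow-up hypothesis replaced by the print's profile P1 p.3 l.28–29 / p.4 l.9–12
(`‖∇v(t)‖_∞ < ∞` for each `t < t*`, `lim sup_{t→t*⁻} ‖∇v(t)‖_∞ = ∞`). It is implied by the typed
`Step3_Correspondence` (`step3Charitable_of_step3`) and it is FALSE for every `κ ≠ 0` by the kit-1 witness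
`R(t,x) = 1/2 + (1/4) sin (x₀/(t* − t))` (`not_Step3_CorrespondenceCharitable`,
`not_forall_Step3_CorrespondenceCharitable`), VACUOUSLY TRUE at `κ = 0` (`step3Charitable_of_kappa_eq_zero`).
No effect on the C96 token, locator, class or totals (records-grade, REF v1b (C)).

WHAT THIS IS NOT: not a claim about NS regularity or blow-up; not a claim about any author beyond the
typed locator.
-/

noncomputable section

set_option linter.dupNamespace false

open Set Function Filter MeasureTheory InnerProductSpace
open scoped Topology ENNReal NNReal ContDiff RealInnerProductSpace

namespace Summit.NavierStokesRegularity.NavierStokesRegularity.Theorems.Svancara2025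

open Literature.Analysis.FluidPDE Literature.Claims.NS.Svancara2025

/-! ### File 2 — the REF's charitable re-typing of Step 3 (print's lim sup profile) is false too

`Step3_CorrespondenceCharitable` is ns-claims-ref-4 g5's maximally charitable functions-grain reading of
§2 Proof p.4 l.13–16 (RETYPE v1b, `claims/Svancara2025/RETYPE.md`): Step 3 with the blow-up hypothesis in
the print's own shape P1 p.3 l.28–29 / p.4 l.9–12 — `‖∇v(t)‖_∞ < ∞` for every `t < t*` AND
`lim sup_{t→t*⁻} ‖∇v(t)‖_∞ = ∞`. The kit-1 witness `R(t,x) = 1/2 + (1/4) sin(x₀/(t* − t))` has exactly this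
profile (`norm_fderiv_vosc_le`: `‖∇v(t)‖_∞ ≤ |κ|/(4(t* − t)²)`; `fderiv_vosc_limsup` below: blow-up beyond
every `t₀ < t*`), and its sub-threshold set is empty at every time — so the charitable face is false for
every `κ ≠ 0` as well (and vacuous at `κ = 0`). -/

/-- **REF's charitable re-typing of Step 3** (RETYPE v1b, ns-claims-ref-4 g5; Lean text verbatim): the
«R_c ↔ v correspondence» step p.4 l.13–16 with per-time boundedness of `‖∇v(t)‖` on `[0,t*)` and the
lim sup blow-up at `t*⁻` as hypotheses. [claim: Svancara2025, status: under-review] [cite: Svancara2025, §2 p.4 l.9–16; p.3 l.26–29] -/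
def Step3_CorrespondenceCharitable (K : Kernel) : Prop :=
  ∀ (R : ℝ → E3 → ℝ) (v : ℝ → E3 → E3) (tstar : ℝ), 0 < tstar →
    (∀ t ∈ Ico 0 tstar, ContDiff ℝ ∞ (R t)) → (∀ t ∈ Ico 0 tstar, ∀ x, R t x ∈ Icc (0 : ℝ) 1) →
    (∀ t ∈ Ico 0 tstar, v t = fun x => K.κ • gradient (R t) x) →
    (∀ t ∈ Ico 0 tstar, ∃ B : ℝ, ∀ x : E3, ‖fderiv ℝ (v t) x‖ ≤ B) →
    (∀ M : ℝ, ∀ t₀ ∈ Ico 0 tstar, ∃ t ∈ Ico t₀ tstar, ∃ x : E3, M < ‖fderiv ℝ (v t) x‖) →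
      ∃ t ∈ Ico 0 tstar, 0 < volume {x : E3 | R t x < Rth}

/-- The charitable face is implied by the typed Step 3 (its hypotheses are stronger), so negating it is a
print-faithful negation of Step 3 (REF v1b). [cite: Svancara2025, §2 p.4 l.13–16] -/
theorem step3Charitable_of_step3 (K : Kernel) (h : Step3_Correspondence K) :
    Step3_CorrespondenceCharitable K := by
  intro R v tstar hts hR hrange hv _ hlimsup
  exact h R v tstar hts hR hrange hv fun M => by
    obtain ⟨t, ht, x, hx⟩ := hlimsup M 0 ⟨le_rfl, hts⟩
    exact ⟨t, ht, x, hx⟩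

/-- lim sup profile of the kit-1 witness: beyond every `t₀ < t*` the gradient exceeds every bound
(`tₙ = t*(1 − 1/(n+1)) ≥ t₀` for `n` large, `‖Dv(tₙ)(xₙ)‖ ≥ |κ| Nₙ²/4`, `Nₙ = (n+1)/t*`). [folklore] -/
theorem fderiv_vosc_limsup (K : Kernel) (hκ : K.κ ≠ 0) {tstar : ℝ} (hts : 0 < tstar) (M : ℝ) {t₀ : ℝ}
    (ht₀ : t₀ ∈ Ico 0 tstar) : ∃ t ∈ Ico t₀ tstar, ∃ x : E3, M < ‖fderiv ℝ (vosc K tstar t) x‖ := by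
  have hκ' : 0 < |K.κ| := abs_pos.2 hκ
  have hgap : 0 < tstar - t₀ := sub_pos.2 ht₀.2
  obtain ⟨n₁, hn₁⟩ := exists_nat_gt (4 * tstar ^ 2 * M / |K.κ|)
  obtain ⟨n₂, hn₂⟩ := exists_nat_gt (tstar / (tstar - t₀))
  set n : ℕ := n₁ + n₂ with hn_def
  have hn : 4 * tstar ^ 2 * M / |K.κ| < n :=
    hn₁.trans_le (by rw [hn_def]; exact_mod_cast Nat.le_add_right n₁ n₂)
  have hn' : tstar / (tstar - t₀) < n + 1 :=
    hn₂.trans_le (by rw [hn_def]; push_cast; linarith [Nat.cast_nonneg (α := ℝ) n₁])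
  have hn1 : (0 : ℝ) < n + 1 := by positivity
  set t : ℝ := tstar - tstar / (n + 1) with ht
  set N : ℝ := (n + 1) / tstar with hN
  have hNpos : 0 < N := by positivity
  have hNof : Nof tstar t = N := by
    rw [Nof, ht, hN]; field_simp; ring
  refine ⟨t, ⟨?_, ?_⟩, (Real.pi / (2 * N)) • e0, ?_⟩
  · -- t₀ ≤ t ⟺ tstar/(n+1) ≤ tstar − t₀ ⟸ tstar < (n+1)(tstar − t₀)
    rw [ht, le_sub_comm, div_le_iff₀ hn1]
    rw [div_lt_iff₀ hgap] at hn'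
    linarith
  · rw [ht, sub_lt_self_iff]; positivity
  have hx0 : ((Real.pi / (2 * N)) • e0) 0 = Real.pi / (2 * N) := by simp [e0]
  have hle := norm_fderiv_vosc_ge K tstar t ((Real.pi / (2 * N)) • e0)
  rw [hx0, hNof, gN''_at N hNpos.ne', abs_div, abs_neg, abs_pow, abs_of_pos hNpos,
    abs_of_pos (by norm_num : (0:ℝ) < 4)] at hle
  have hM : M < |K.κ| * (N ^ 2 / 4) := by
    rw [div_lt_iff₀ hκ'] at hn
    have h1 : (n : ℝ) < (n + 1) * (n + 1) := by nlinarith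
    have h2 : 4 * tstar ^ 2 * M < |K.κ| * ((n + 1) * (n + 1)) := hn.trans (by nlinarith)
    have h3 : |K.κ| * (N ^ 2 / 4) = |K.κ| * ((n + 1) * (n + 1)) / (4 * tstar ^ 2) := by
      rw [hN]; field_simp
    rw [h3, lt_div_iff₀ (by positivity)]
    linarith
  exact hM.trans_le hle

/-- **The charitable face of Step 3 is false for every kernel constant `κ ≠ 0`** — same witness as
`not_Step3_Correspondence`, now checked against the print's blow-up profile (bounded per time by
`norm_fderiv_vosc_le`, lim sup by `fderiv_vosc_limsup`); the sub-threshold set `{R(t) < R_th}` is empty at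
every time. Class: false lemma (countermodel), print-faithful grain (REF v1b). Records-grade: no effect
on the C96 token. [cite: Svancara2025, §2 p.4 l.13–16; p.3 l.26–29] -/
theorem not_Step3_CorrespondenceCharitable (K : Kernel) (hκ : K.κ ≠ 0) :
    ¬ Step3_CorrespondenceCharitable K := by
  intro h
  obtain ⟨t, -, hvol⟩ := h (Rosc 1) (vosc K 1) 1 one_pos (fun t _ => contDiff_Rosc 1 t)
    (fun t _ x => Rosc_mem 1 t x) (fun _ _ => rfl)
    (fun t _ => ⟨|K.κ| * ((Nof 1 t) ^ 2 / 4), fun x => norm_fderiv_vosc_le K 1 t x⟩)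
    (fun M t₀ ht₀ => fderiv_vosc_limsup K hκ one_pos M ht₀)
  rw [setOf_Rosc_lt_Rth_eq_empty, measure_empty] at hvol
  exact lt_irrefl _ hvol

/-- The family over all kernels fails at `κ = 1`. [cite: Svancara2025, §2 p.4 l.13–16] -/
theorem not_forall_Step3_CorrespondenceCharitable : ¬ ∀ K : Kernel, Step3_CorrespondenceCharitable K :=
  fun h => not_Step3_CorrespondenceCharitable ⟨1, fun _ => True⟩ one_ne_zero (h _)

/-- At `κ = 0` the charitable face holds VACUOUSLY (its lim sup hypothesis fails for `v ≡ 0`): the side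
condition `κ ≠ 0` is sharp. [cite: Svancara2025, §2 p.4 l.13–16] -/
theorem step3Charitable_of_kappa_eq_zero (K : Kernel) (hκ : K.κ = 0) :
    Step3_CorrespondenceCharitable K := by
  intro R v tstar hts _ _ hv _ hlimsup
  exfalso
  obtain ⟨t, ht, x, hx⟩ := hlimsup 0 0 ⟨le_rfl, hts⟩
  rw [hv t ht, hκ] at hx
  simp at hx


end Summit.NavierStokesRegularity.NavierStokesRegularity.Theorems.Svancara2025
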